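import Literature.Geometry.DiscreteGeometry.KissingRigidity
import HarnessLib

/-!
# Cap atoms for the birth line of `ZeroDefectDensity` — I: combinatorics of the two pattern graphs
# (route `HullExactificationCascade`, crux `ZeroDefectDensity`, stmt-AtomisticToContinuum-12086; stub `stub_capAtoms`)

Support file (lead c4, stub-worker) for the registered stub `stub_capAtoms` of
`Cruxes/ZeroDefectDensity/Lines/birth.lean`: every induced soft 4-cycle of a softly twelve-kissed shell
whose soft contact graph — and those of its neighbours — is the fcc (cuboctahedron) or the hcp
(anticuboctahedron) pattern graph is capped by a common soft contact.  The proof of the stub is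
combinatorics of the two pattern graphs plus Euler's quadrilateral inequality and the link lemma;
this file supplies the COMBINATORICS, checked by `decide` on the integer models `fccTab`, `hcpTab`
(adjacency `fccAdj i j : sqNormInt (fccTab i - fccTab j) = 2`, `hcpAdj` with `18`) of
`Literature/Geometry/DiscreteGeometry/KissingRigidity.lean`:

* `fcc_chart`, `hcp_chart` — the enumeration `i ↦ tab i / √N` is a bijection `Fin 12 ≃ pattern` turning
  `dist = 1` into `fccAdj` / `hcpAdj` (so a `LocalHalesKernel`-type isomorphism of a soft shell with a
  pattern becomes a labelling of the shell by `Fin 12`).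
* `fcc_adj_symm`, `fcc_adj_irrefl`, `hcp_adj_symm`, `hcp_adj_irrefl`.
* `fcc_link`, `hcp_link` — THE LINK LABELLING: every vertex `c` has neighbours `n₀ n₁ n₂ n₃` with
  `n₀ ~ n₁`, the pairs `(n₀,n₂)`, `(n₁,n₃)`, `(n₃,n₀)` non-adjacent, and either (type `(3,4,3,4)`)
  `n₂ ~ n₃`, `(n₁,n₂)` a non-adjacent SQUARE-TYPE pair (some `k ≠ c` is adjacent to both and not to `c`),
  or (type `(3,3,4,4)`, the hexagonal layer of hcp) `n₁ ~ n₂`, `(n₂,n₃)` non-adjacent; and the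
  non-adjacent NON-square pairs of neighbours of `c` are exactly `{n₀,n₂}` and `{n₁,n₃}` — the two pairs
  the link lemma of the line certifies to be metrically `≥ 8/5`.
* `fcc_close5`, `hcp_close5` — THE CLOSING CONFIGURATION: if `v ~ a`, `v ~ b`, `a ≠ b`, `a ≁ b`,
  `x ~ a`, `x ≠ v`, `x ≁ v`, `y ~ b`, `y ≠ v`, `y ≁ v`, and each of the pairs `(a,b)`, `(v,x)`, `(v,y)`,
  `(x,y)` is "close-compatible" (square-type at every common neighbour, when distinct and non-adjacent),
  then `x = y`.  (Brute force over the `384` / `420` such configurations; proved through a neighbour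
  table so that `decide` enumerates `12·4⁴` cases.)

No new definitions; tables live inside proofs.  Everything here is finite combinatorics. [folklore]
-/

namespace Summit.AtomisticToContinuum.Crystallization.Theorems.ZeroDefectDensityBirth

open Literature.Geometry.DiscreteGeometry

/-! ## Scaled integer patterns: `dist = 1` is integer arithmetic -/

/-- `dist (s/√N) (t/√N) = 1 ↔ |s - t|² = N` for integer vectors (`N ≠ 0`). [folklore] -/
theorem dist_smul_intVec_eq_one_iff {N : ℕ} (hN : N ≠ 0) (s t : Fin 3 → ℤ) :
    dist ((Real.sqrt N)⁻¹ • intVec s) ((Real.sqrt N)⁻¹ • intVec t) = 1 ↔ sqNormInt (s - t) = N := by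
  rw [← dist_refPt_eq_two_iff hN, refPt, refPt, dist_smul₀ (2 : ℝ), Real.norm_two]
  constructor <;> intro h <;> linarith

/-- The enumeration `fccTab` is a bijection `Fin 12 ≃ fccKissingPattern` under which `dist = 1` is
`fccAdj`. [folklore] -/
theorem fcc_chart : ∃ f : Fin 12 ≃ {q : EuclideanSpace ℝ (Fin 3) // q ∈ fccKissingPattern},
    ∀ i j : Fin 12, (dist (f i).1 (f j).1 = 1 ↔ fccAdj i j) := by
  have hmem : ∀ i : Fin 12, (Real.sqrt ((2 : ℕ) : ℝ))⁻¹ • intVec (fccTab i) ∈ fccKissingPattern := by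
    intro i
    rw [fccKissingPattern, scaledPattern, fccInt_eq_image, Finset.image_image]
    exact Finset.mem_image.2 ⟨i, Finset.mem_univ _, rfl⟩
  let g : Fin 12 → {q : EuclideanSpace ℝ (Fin 3) // q ∈ fccKissingPattern} :=
    fun i => ⟨(Real.sqrt ((2 : ℕ) : ℝ))⁻¹ • intVec (fccTab i), hmem i⟩
  have hinj : Function.Injective g := fun i j h =>
    fccTab_injective (scaledPattern_map_injective two_ne_zero (congrArg Subtype.val h))
  have hsurj : Function.Surjective g := by
    rintro ⟨q, hq⟩
    rw [fccKissingPattern, scaledPattern, fccInt_eq_image, Finset.image_image] at hq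
    obtain ⟨i, -, rfl⟩ := Finset.mem_image.1 hq
    exact ⟨i, rfl⟩
  exact ⟨Equiv.ofBijective g ⟨hinj, hsurj⟩, fun i j => dist_smul_intVec_eq_one_iff two_ne_zero _ _⟩

/-- The enumeration `hcpTab` is a bijection `Fin 12 ≃ hcpKissingPattern` under which `dist = 1` is
`hcpAdj`. [folklore] -/
theorem hcp_chart : ∃ f : Fin 12 ≃ {q : EuclideanSpace ℝ (Fin 3) // q ∈ hcpKissingPattern},
    ∀ i j : Fin 12, (dist (f i).1 (f j).1 = 1 ↔ hcpAdj i j) := by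
  have h18 : (18 : ℕ) ≠ 0 := by norm_num
  have hmem : ∀ i : Fin 12, (Real.sqrt ((18 : ℕ) : ℝ))⁻¹ • intVec (hcpTab i) ∈ hcpKissingPattern := by
    intro i
    rw [hcpKissingPattern, scaledPattern, hcpInt_eq_image, Finset.image_image]
    exact Finset.mem_image.2 ⟨i, Finset.mem_univ _, rfl⟩
  let g : Fin 12 → {q : EuclideanSpace ℝ (Fin 3) // q ∈ hcpKissingPattern} :=
    fun i => ⟨(Real.sqrt ((18 : ℕ) : ℝ))⁻¹ • intVec (hcpTab i), hmem i⟩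
  have hinj : Function.Injective g := fun i j h =>
    hcpTab_injective (scaledPattern_map_injective h18 (congrArg Subtype.val h))
  have hsurj : Function.Surjective g := by
    rintro ⟨q, hq⟩
    rw [hcpKissingPattern, scaledPattern, hcpInt_eq_image, Finset.image_image] at hq
    obtain ⟨i, -, rfl⟩ := Finset.mem_image.1 hq
    exact ⟨i, rfl⟩
  exact ⟨Equiv.ofBijective g ⟨hinj, hsurj⟩, fun i j => dist_smul_intVec_eq_one_iff h18 _ _⟩

/-! ## The fcc pattern graph -/

/-- `fccAdj` is symmetric. [folklore] -/
theorem fcc_adj_symm : ∀ i j : Fin 12, fccAdj i j → fccAdj j i := by decide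

/-- `fccAdj` is irreflexive. [folklore] -/
theorem fcc_adj_irrefl : ∀ i : Fin 12, ¬ fccAdj i i := by decide

-- `decide` needs a larger instance-size budget for these long decidable propositions (no heartbeat change).
set_option synthInstance.maxSize 2048 in
/-- **Link labelling of the fcc pattern graph.** Every vertex `c` has neighbours `n₀ n₁ n₂ n₃`
with `n₀ ~ n₁`; `(n₀,n₂)`, `(n₁,n₃)`, `(n₃,n₀)` distinct and non-adjacent; type `(3,4,3,4)`
(`n₂ ~ n₃`, `(n₁,n₂)` a non-adjacent square-type pair) or type `(3,3,4,4)` (`n₁ ~ n₂`, `(n₂,n₃)`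
non-adjacent); and the non-adjacent non-square pairs among the neighbours of `c` are exactly
`{n₀,n₂}`, `{n₁,n₃}`. [folklore] -/
theorem fcc_link : ∀ c : Fin 12, ∃ n₀ n₁ n₂ n₃ : Fin 12,
    fccAdj c n₀ ∧ fccAdj c n₁ ∧ fccAdj c n₂ ∧ fccAdj c n₃ ∧ fccAdj n₀ n₁ ∧
    n₀ ≠ n₂ ∧ ¬ fccAdj n₀ n₂ ∧ n₁ ≠ n₃ ∧ ¬ fccAdj n₁ n₃ ∧ n₃ ≠ n₀ ∧ ¬ fccAdj n₃ n₀ ∧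
    ((fccAdj n₂ n₃ ∧ n₁ ≠ n₂ ∧ ¬ fccAdj n₁ n₂ ∧
        ∃ k : Fin 12, k ≠ c ∧ fccAdj k n₁ ∧ fccAdj k n₂ ∧ ¬ fccAdj k c) ∨
      (fccAdj n₁ n₂ ∧ n₂ ≠ n₃ ∧ ¬ fccAdj n₂ n₃)) ∧
    ∀ a b : Fin 12, fccAdj c a → fccAdj c b → a ≠ b → ¬ fccAdj a b →
      (¬ ∃ k : Fin 12, k ≠ c ∧ fccAdj k a ∧ fccAdj k b ∧ ¬ fccAdj k c) →
      ((a = n₀ ∧ b = n₂) ∨ (a = n₂ ∧ b = n₀) ∨ (a = n₁ ∧ b = n₃) ∨ (a = n₃ ∧ b = n₁)) := by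
  decide +kernel

/-- Neighbour table of the fcc pattern graph (internal; the table is the hypothesis). [folklore] -/
theorem fcc_nb_complete : ∀ nb : Fin 12 → Fin 4 → Fin 12,
    nb = ![![4, 8, 9, 5], ![4, 10, 11, 5], ![6, 8, 9, 7], ![6, 10, 11, 7], ![0, 8, 10, 1], ![0, 9, 11, 1], ![2, 8, 10, 3], ![2, 9, 11, 3], ![0, 4, 6, 2], ![0, 5, 7, 2], ![1, 4, 6, 3], ![1, 5, 7, 3]] →
    ∀ i j : Fin 12, fccAdj i j → ∃ k : Fin 4, nb i k = j := by
  rintro nb rfl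
  decide

-- `decide` needs a larger instance-size budget for this long decidable proposition (no heartbeat change).
set_option synthInstance.maxSize 2048 in
/-- The closing configuration of the fcc pattern graph, enumerated through the neighbour table
(internal form of `fcc_close5`). [folklore] -/
theorem fcc_close5_nb : ∀ nb : Fin 12 → Fin 4 → Fin 12,
    nb = ![![4, 8, 9, 5], ![4, 10, 11, 5], ![6, 8, 9, 7], ![6, 10, 11, 7], ![0, 8, 10, 1], ![0, 9, 11, 1], ![2, 8, 10, 3], ![2, 9, 11, 3], ![0, 4, 6, 2], ![0, 5, 7, 2], ![1, 4, 6, 3], ![1, 5, 7, 3]] →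
    ∀ v : Fin 12, ∀ ka kb kx ky : Fin 4,
    nb v ka ≠ nb v kb → ¬ fccAdj (nb v ka) (nb v kb) →
    nb (nb v ka) kx ≠ v → ¬ fccAdj (nb (nb v ka) kx) v →
    nb (nb v kb) ky ≠ v → ¬ fccAdj (nb (nb v kb) ky) v →
    (∀ c : Fin 12, fccAdj c (nb v ka) → fccAdj c (nb v kb) →
        ∃ k : Fin 12, k ≠ c ∧ fccAdj k (nb v ka) ∧ fccAdj k (nb v kb) ∧ ¬ fccAdj k c) →
    (∀ c : Fin 12, fccAdj c v → fccAdj c (nb (nb v ka) kx) →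
        ∃ k : Fin 12, k ≠ c ∧ fccAdj k v ∧ fccAdj k (nb (nb v ka) kx) ∧ ¬ fccAdj k c) →
    (∀ c : Fin 12, fccAdj c v → fccAdj c (nb (nb v kb) ky) →
        ∃ k : Fin 12, k ≠ c ∧ fccAdj k v ∧ fccAdj k (nb (nb v kb) ky) ∧ ¬ fccAdj k c) →
    (nb (nb v ka) kx ≠ nb (nb v kb) ky → ¬ fccAdj (nb (nb v ka) kx) (nb (nb v kb) ky) →
      ∀ c : Fin 12, fccAdj c (nb (nb v ka) kx) → fccAdj c (nb (nb v kb) ky) →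
        ∃ k : Fin 12, k ≠ c ∧ fccAdj k (nb (nb v ka) kx) ∧ fccAdj k (nb (nb v kb) ky) ∧ ¬ fccAdj k c) →
    nb (nb v ka) kx = nb (nb v kb) ky := by
  rintro nb rfl
  decide

/-- **The closing configuration of the fcc pattern graph.** If `v ~ a`, `v ~ b`, `a ≠ b`, `a ≁ b`,
`x ~ a`, `x ≠ v`, `x ≁ v`, `y ~ b`, `y ≠ v`, `y ≁ v`, the pairs `(a,b)`, `(v,x)`, `(v,y)` are square-type
at every common neighbour, and so is `(x,y)` if distinct and non-adjacent, then `x = y`.  (In the stub: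
`v` the centre `u`, `a, b = z₁, z₃`, `x, y` the fourth corners found in the shells of `z₁` and `z₃`,
all read in the shell of `z₂`.) [folklore] -/
theorem fcc_close5 : ∀ v a b x y : Fin 12, fccAdj v a → fccAdj v b → a ≠ b → ¬ fccAdj a b →
    fccAdj x a → x ≠ v → ¬ fccAdj x v → fccAdj y b → y ≠ v → ¬ fccAdj y v →
    (∀ c : Fin 12, fccAdj c a → fccAdj c b → ∃ k : Fin 12, k ≠ c ∧ fccAdj k a ∧ fccAdj k b ∧ ¬ fccAdj k c) →
    (∀ c : Fin 12, fccAdj c v → fccAdj c x → ∃ k : Fin 12, k ≠ c ∧ fccAdj k v ∧ fccAdj k x ∧ ¬ fccAdj k c) →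
    (∀ c : Fin 12, fccAdj c v → fccAdj c y → ∃ k : Fin 12, k ≠ c ∧ fccAdj k v ∧ fccAdj k y ∧ ¬ fccAdj k c) →
    (x ≠ y → ¬ fccAdj x y →
      ∀ c : Fin 12, fccAdj c x → fccAdj c y → ∃ k : Fin 12, k ≠ c ∧ fccAdj k x ∧ fccAdj k y ∧ ¬ fccAdj k c) →
    x = y := by
  intro v a b x y hva hvb hab hnab hxa hxv hnxv hyb hyv hnyv h₁ h₂ h₃ h₄
  obtain ⟨ka, rfl⟩ := fcc_nb_complete _ rfl v a hva
  obtain ⟨kb, rfl⟩ := fcc_nb_complete _ rfl v b hvb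
  obtain ⟨kx, rfl⟩ := fcc_nb_complete _ rfl _ x (fcc_adj_symm _ _ hxa)
  obtain ⟨ky, rfl⟩ := fcc_nb_complete _ rfl _ y (fcc_adj_symm _ _ hyb)
  exact fcc_close5_nb _ rfl v ka kb kx ky hab hnab hxv hnxv hyv hnyv h₁ h₂ h₃ h₄

/-! ## The hcp pattern graph -/

/-- `hcpAdj` is symmetric. [folklore] -/
theorem hcp_adj_symm : ∀ i j : Fin 12, hcpAdj i j → hcpAdj j i := by decide

/-- `hcpAdj` is irreflexive. [folklore] -/
theorem hcp_adj_irrefl : ∀ i : Fin 12, ¬ hcpAdj i i := by decide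

-- `decide` needs a larger instance-size budget for these long decidable propositions (no heartbeat change).
set_option synthInstance.maxSize 2048 in
/-- **Link labelling of the hcp pattern graph.** Every vertex `c` has neighbours `n₀ n₁ n₂ n₃`
with `n₀ ~ n₁`; `(n₀,n₂)`, `(n₁,n₃)`, `(n₃,n₀)` distinct and non-adjacent; type `(3,4,3,4)`
(`n₂ ~ n₃`, `(n₁,n₂)` a non-adjacent square-type pair) or type `(3,3,4,4)` (`n₁ ~ n₂`, `(n₂,n₃)`
non-adjacent); and the non-adjacent non-square pairs among the neighbours of `c` are exactly
`{n₀,n₂}`, `{n₁,n₃}`. [folklore] -/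
theorem hcp_link : ∀ c : Fin 12, ∃ n₀ n₁ n₂ n₃ : Fin 12,
    hcpAdj c n₀ ∧ hcpAdj c n₁ ∧ hcpAdj c n₂ ∧ hcpAdj c n₃ ∧ hcpAdj n₀ n₁ ∧
    n₀ ≠ n₂ ∧ ¬ hcpAdj n₀ n₂ ∧ n₁ ≠ n₃ ∧ ¬ hcpAdj n₁ n₃ ∧ n₃ ≠ n₀ ∧ ¬ hcpAdj n₃ n₀ ∧
    ((hcpAdj n₂ n₃ ∧ n₁ ≠ n₂ ∧ ¬ hcpAdj n₁ n₂ ∧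
        ∃ k : Fin 12, k ≠ c ∧ hcpAdj k n₁ ∧ hcpAdj k n₂ ∧ ¬ hcpAdj k c) ∨
      (hcpAdj n₁ n₂ ∧ n₂ ≠ n₃ ∧ ¬ hcpAdj n₂ n₃)) ∧
    ∀ a b : Fin 12, hcpAdj c a → hcpAdj c b → a ≠ b → ¬ hcpAdj a b →
      (¬ ∃ k : Fin 12, k ≠ c ∧ hcpAdj k a ∧ hcpAdj k b ∧ ¬ hcpAdj k c) →
      ((a = n₀ ∧ b = n₂) ∨ (a = n₂ ∧ b = n₀) ∨ (a = n₁ ∧ b = n₃) ∨ (a = n₃ ∧ b = n₁)) := by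
  decide +kernel

/-- Neighbour table of the hcp pattern graph (internal; the table is the hypothesis). [folklore] -/
theorem hcp_nb_complete : ∀ nb : Fin 12 → Fin 4 → Fin 12,
    nb = ![![7, 5, 10, 2], ![8, 3, 11, 4], ![6, 4, 9, 0], ![8, 1, 11, 5], ![6, 2, 9, 1], ![7, 0, 10, 3], ![2, 4, 8, 7], ![0, 5, 8, 6], ![1, 3, 7, 6], ![2, 4, 11, 10], ![0, 5, 11, 9], ![1, 3, 10, 9]] →
    ∀ i j : Fin 12, hcpAdj i j → ∃ k : Fin 4, nb i k = j := by
  rintro nb rfl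
  decide

-- `decide` needs a larger instance-size budget for this long decidable proposition (no heartbeat change).
set_option synthInstance.maxSize 2048 in
/-- The closing configuration of the hcp pattern graph, enumerated through the neighbour table
(internal form of `hcp_close5`). [folklore] -/
theorem hcp_close5_nb : ∀ nb : Fin 12 → Fin 4 → Fin 12,
    nb = ![![7, 5, 10, 2], ![8, 3, 11, 4], ![6, 4, 9, 0], ![8, 1, 11, 5], ![6, 2, 9, 1], ![7, 0, 10, 3], ![2, 4, 8, 7], ![0, 5, 8, 6], ![1, 3, 7, 6], ![2, 4, 11, 10], ![0, 5, 11, 9], ![1, 3, 10, 9]] →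
    ∀ v : Fin 12, ∀ ka kb kx ky : Fin 4,
    nb v ka ≠ nb v kb → ¬ hcpAdj (nb v ka) (nb v kb) →
    nb (nb v ka) kx ≠ v → ¬ hcpAdj (nb (nb v ka) kx) v →
    nb (nb v kb) ky ≠ v → ¬ hcpAdj (nb (nb v kb) ky) v →
    (∀ c : Fin 12, hcpAdj c (nb v ka) → hcpAdj c (nb v kb) →
        ∃ k : Fin 12, k ≠ c ∧ hcpAdj k (nb v ka) ∧ hcpAdj k (nb v kb) ∧ ¬ hcpAdj k c) →
    (∀ c : Fin 12, hcpAdj c v → hcpAdj c (nb (nb v ka) kx) →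
        ∃ k : Fin 12, k ≠ c ∧ hcpAdj k v ∧ hcpAdj k (nb (nb v ka) kx) ∧ ¬ hcpAdj k c) →
    (∀ c : Fin 12, hcpAdj c v → hcpAdj c (nb (nb v kb) ky) →
        ∃ k : Fin 12, k ≠ c ∧ hcpAdj k v ∧ hcpAdj k (nb (nb v kb) ky) ∧ ¬ hcpAdj k c) →
    (nb (nb v ka) kx ≠ nb (nb v kb) ky → ¬ hcpAdj (nb (nb v ka) kx) (nb (nb v kb) ky) →
      ∀ c : Fin 12, hcpAdj c (nb (nb v ka) kx) → hcpAdj c (nb (nb v kb) ky) →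
        ∃ k : Fin 12, k ≠ c ∧ hcpAdj k (nb (nb v ka) kx) ∧ hcpAdj k (nb (nb v kb) ky) ∧ ¬ hcpAdj k c) →
    nb (nb v ka) kx = nb (nb v kb) ky := by
  rintro nb rfl
  decide

/-- **The closing configuration of the hcp pattern graph.** If `v ~ a`, `v ~ b`, `a ≠ b`, `a ≁ b`,
`x ~ a`, `x ≠ v`, `x ≁ v`, `y ~ b`, `y ≠ v`, `y ≁ v`, the pairs `(a,b)`, `(v,x)`, `(v,y)` are square-type
at every common neighbour, and so is `(x,y)` if distinct and non-adjacent, then `x = y`.  (In the stub: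
`v` the centre `u`, `a, b = z₁, z₃`, `x, y` the fourth corners found in the shells of `z₁` and `z₃`,
all read in the shell of `z₂`.) [folklore] -/
theorem hcp_close5 : ∀ v a b x y : Fin 12, hcpAdj v a → hcpAdj v b → a ≠ b → ¬ hcpAdj a b →
    hcpAdj x a → x ≠ v → ¬ hcpAdj x v → hcpAdj y b → y ≠ v → ¬ hcpAdj y v →
    (∀ c : Fin 12, hcpAdj c a → hcpAdj c b → ∃ k : Fin 12, k ≠ c ∧ hcpAdj k a ∧ hcpAdj k b ∧ ¬ hcpAdj k c) →
    (∀ c : Fin 12, hcpAdj c v → hcpAdj c x → ∃ k : Fin 12, k ≠ c ∧ hcpAdj k v ∧ hcpAdj k x ∧ ¬ hcpAdj k c) →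
    (∀ c : Fin 12, hcpAdj c v → hcpAdj c y → ∃ k : Fin 12, k ≠ c ∧ hcpAdj k v ∧ hcpAdj k y ∧ ¬ hcpAdj k c) →
    (x ≠ y → ¬ hcpAdj x y →
      ∀ c : Fin 12, hcpAdj c x → hcpAdj c y → ∃ k : Fin 12, k ≠ c ∧ hcpAdj k x ∧ hcpAdj k y ∧ ¬ hcpAdj k c) →
    x = y := by
  intro v a b x y hva hvb hab hnab hxa hxv hnxv hyb hyv hnyv h₁ h₂ h₃ h₄
  obtain ⟨ka, rfl⟩ := hcp_nb_complete _ rfl v a hva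
  obtain ⟨kb, rfl⟩ := hcp_nb_complete _ rfl v b hvb
  obtain ⟨kx, rfl⟩ := hcp_nb_complete _ rfl _ x (hcp_adj_symm _ _ hxa)
  obtain ⟨ky, rfl⟩ := hcp_nb_complete _ rfl _ y (hcp_adj_symm _ _ hyb)
  exact hcp_close5_nb _ rfl v ka kb kx ky hab hnab hxv hnxv hyv hnyv h₁ h₂ h₃ h₄

/-! ## Registered sub-goal (one line, fully qualified): the closing configuration in both patterns -/

/-- **Registered sub-goal `pattern_close5`** (helper of `stub_capAtoms`, lead c4): the closing
configuration `fcc_close5 ∧ hcp_close5`, verbatim the registered one-line signature. [folklore] -/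
theorem pattern_close5 : (∀ v a b x y : Fin 12, Literature.Geometry.DiscreteGeometry.fccAdj v a → Literature.Geometry.DiscreteGeometry.fccAdj v b → a ≠ b → ¬ Literature.Geometry.DiscreteGeometry.fccAdj a b → Literature.Geometry.DiscreteGeometry.fccAdj x a → x ≠ v → ¬ Literature.Geometry.DiscreteGeometry.fccAdj x v → Literature.Geometry.DiscreteGeometry.fccAdj y b → y ≠ v → ¬ Literature.Geometry.DiscreteGeometry.fccAdj y v → (∀ c : Fin 12, Literature.Geometry.DiscreteGeometry.fccAdj c a → Literature.Geometry.DiscreteGeometry.fccAdj c b → ∃ k : Fin 12, k ≠ c ∧ Literature.Geometry.DiscreteGeometry.fccAdj k a ∧ Literature.Geometry.DiscreteGeometry.fccAdj k b ∧ ¬ Literature.Geometry.DiscreteGeometry.fccAdj k c) → (∀ c : Fin 12, Literature.Geometry.DiscreteGeometry.fccAdj c v → Literature.Geometry.DiscreteGeometry.fccAdj c x → ∃ k : Fin 12, k ≠ c ∧ Literature.Geometry.DiscreteGeometry.fccAdj k v ∧ Literature.Geometry.DiscreteGeometry.fccAdj k x ∧ ¬ Literature.Geometry.DiscreteGeometry.fccAdj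 k c) → (∀ c : Fin 12, Literature.Geometry.DiscreteGeometry.fccAdj c v → Literature.Geometry.DiscreteGeometry.fccAdj c y → ∃ k : Fin 12, k ≠ c ∧ Literature.Geometry.DiscreteGeometry.fccAdj k v ∧ Literature.Geometry.DiscreteGeometry.fccAdj k y ∧ ¬ Literature.Geometry.DiscreteGeometry.fccAdj k c) → (x ≠ y → ¬ Literature.Geometry.DiscreteGeometry.fccAdj x y → ∀ c : Fin 12, Literature.Geometry.DiscreteGeometry.fccAdj c x → Literature.Geometry.DiscreteGeometry.fccAdj c y → ∃ k : Fin 12, k ≠ c ∧ Literature.Geometry.DiscreteGeometry.fccAdj k x ∧ Literature.Geometry.DiscreteGeometry.fccAdj k y ∧ ¬ Literature.Geometry.DiscreteGeometry.fccAdj k c) → x = y) ∧ (∀ v a b x y : Fin 12, Literature.Geometry.DiscreteGeometry.hcpAdj v a → Literature.Geometry.DiscreteGeometry.hcpAdj v b → a ≠ b → ¬ Literature.Geometry.DiscreteGeometry.hcpAdj a b → Literature.Geometry.DiscreteGeometry.hcpAdj x a → x ≠ v → ¬ Literature.Geometry.DiscreteGeometry.hcpAdj x v → Literature.Geometry.DiscreteGeometry.hcpAdj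 y b → y ≠ v → ¬ Literature.Geometry.DiscreteGeometry.hcpAdj y v → (∀ c : Fin 12, Literature.Geometry.DiscreteGeometry.hcpAdj c a → Literature.Geometry.DiscreteGeometry.hcpAdj c b → ∃ k : Fin 12, k ≠ c ∧ Literature.Geometry.DiscreteGeometry.hcpAdj k a ∧ Literature.Geometry.DiscreteGeometry.hcpAdj k b ∧ ¬ Literature.Geometry.DiscreteGeometry.hcpAdj k c) → (∀ c : Fin 12, Literature.Geometry.DiscreteGeometry.hcpAdj c v → Literature.Geometry.DiscreteGeometry.hcpAdj c x → ∃ k : Fin 12, k ≠ c ∧ Literature.Geometry.DiscreteGeometry.hcpAdj k v ∧ Literature.Geometry.DiscreteGeometry.hcpAdj k x ∧ ¬ Literature.Geometry.DiscreteGeometry.hcpAdj k c) → (∀ c : Fin 12, Literature.Geometry.DiscreteGeometry.hcpAdj c v → Literature.Geometry.DiscreteGeometry.hcpAdj c y → ∃ k : Fin 12, k ≠ c ∧ Literature.Geometry.DiscreteGeometry.hcpAdj k v ∧ Literature.Geometry.DiscreteGeometry.hcpAdj k y ∧ ¬ Literature.Geometry.DiscreteGeometry.hcpAdj k c) → (x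 ≠ y → ¬ Literature.Geometry.DiscreteGeometry.hcpAdj x y → ∀ c : Fin 12, Literature.Geometry.DiscreteGeometry.hcpAdj c x → Literature.Geometry.DiscreteGeometry.hcpAdj c y → ∃ k : Fin 12, k ≠ c ∧ Literature.Geometry.DiscreteGeometry.hcpAdj k x ∧ Literature.Geometry.DiscreteGeometry.hcpAdj k y ∧ ¬ Literature.Geometry.DiscreteGeometry.hcpAdj k c) → x = y) :=
  ⟨fcc_close5, hcp_close5⟩

end Summit.AtomisticToContinuum.Crystallization.Theorems.ZeroDefectDensityBirth
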